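import Mathlib
import Literature.MathematicalPhysics.QuantumFieldTheory.MagnenRivasseauSeneor1993.MRS93PositionSpaceFields
import Literature.MathematicalPhysics.QuantumFieldTheory.MagnenRivasseauSeneor1993.MRS93TruncatedGaugeDefect
import HarnessLib

/-!
# Magnen–Rivasseau–Sénéor (CMP 155, 1993), Sect. IV display (IV.2) p.353 OVER `Λ` — «F²_sp(A) + ⟨A, p₀²A⟩ = F²(A′) +
# M(A, γ), M(A, γ) = O(λ²)» for the cut-off fields on the torus: the truncated transform `A′ ≡ A^{γ,2}` of (II.6) AS A
# POSITION-SPACE FIELD, its honest 1-jet, and READING (J) of `…MRS93TruncatedGaugeDefect` DISCHARGED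

statement-level skeleton of a published definition/display with citation tags; the algebra and the finite Fourier analysis
proved; nothing here is a claim about the Yang–Mills mass gap, about continuum Yang–Mills on `T⁴` without infrared cutoff,
or about the Clay problem — and nothing of Magnen–Rivasseau–Sénéor's expansion or estimates is asserted or formalised

**Citation header (reproduction of PUBLISHED work).** J. Magnen, V. Rivasseau, R. Sénéor, *Construction of YM₄ with
an infrared cutoff*, Commun. Math. Phys. **155** (1993) 325–383 [MagnenRivasseauSeneor1993], Sect. IV p.353 tl.2–5 with
the display (IV.2), p.352 tl.26–27; Sect. II.A (II.1)–(II.2) p.328 tl.28–35, (II.5)–(II.6) p.329 tl.9–18, (II.9)–(II.10)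
p.330 tl.6–10; Sect. II.C (II.32b)–(II.32c) p.338 tl.42–46, p.339 tl.2–3; Sect. II.E p.342 tl.5–7; Sect. IV (IV.4) p.354; Sect. VIII p.377 tl.22–23. Loci `p.NNN tl.nn` = journal page / text-layer line of
the held scan `paper:magnen1993-cmp155-mrs-ym4-infrared-cutoff` (PDF page = journal page − 324); (IV.2) as re-read on the
page image by this seat's gen 10 (`…MRS93TruncatedGaugeDefect`; 2× crop `run/shared/lean/pub/pub-balaban-gaps/
pub-balaban-gaps-mrs-lit-1/g10/renders/p29_crop_r350-1150_s2.png`). Cell pub-balaban-gaps (YM blitz, track G3 «MRS 1993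
typed AS PRINTED as the independent second ultraviolet route»), seat mrs-lit-1 (gen 14); companion prose
`run/shared/lean/pub/pub-balaban-gaps/g3/MRS-AS-PRINTED.md` §2, §5; registry `g3/REGISTRY-G3-gen14-tgdi.md`. Builds, BY
NAME and without re-declaring anything, on `…MRS93PositionSpaceFields` (this seat, gens 9–13: the flat torus `Pos`, `vol`,
characters, trigonometric polynomials, the honest `∂_μ` = `HasPartialAt`/`pderiv`, the synthesised cut-off field `field`,
(II.1)/(II.2) in position space, the jets `jetAt`/`gaugeJetAt`, (II.5) in position space `covDPos`, §11 READING (J) for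
Sect. VIII) and on `…MRS93TruncatedGaugeDefect` (gens 10 ∕ 12: (IV.2) on pointwise jets — `defectM`, `M2`, `eqIV2`,
`eqIV2_axial`, `defectM_eq`, `remT`, `defectM_smul_eq`, `hasDerivAt_const_add_sq_mul_of_continuousAt`, `GaugeJet.smul`),
hence on gen 5's (II.5)/(II.6) jet maps `InfinitesimalGauge.covD`/`covDDer`/`gaugeTrunc2`, gen 7's `AxialWard.S0` and gen 3's
`MainStatement.action`/`Fsp`/`quadTime` with (II.9) `action_eq_quadTime_add_Fsp`. (Filed as a separate leaf rather than as
a v1.4 append of `…MRS93PositionSpaceFields` only because that file has reached the gate's 200 000-byte content cap; the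
append form, identical in Lean content, elaborated rc 0 on the check farm.)

**What the paper prints (verbatim; p.353 from the page image as recorded in `…MRS93TruncatedGaugeDefect`).** p.353 tl.2–5
with (IV.2): *«The Yang-Mills action is invariant under exact gauge transformations. However if we use truncated
transformations, i.e. such as A′ ≡ A^{γ,2} the action is not exactly invariant, but the difference is a complicated
polynomial with at least two powers of λ: F²_sp(A) + ⟨A, p₀²A⟩ = F²(A′) + M(A, γ),  M(A, γ) = O(λ²). (IV.2)»*; p.352
tl.26–27: *«This starting point is clearly well defined because we have both finite volume and ultraviolet cutoff on each
of the fields involved. Hence the sample fields are smooth.»*; (II.6) p.329 tl.16–18: *«Then we should define A^{γ,2}_μ =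
A_μ + D_μγ + λ/2[γ, ∂_μγ]. (II.6) This "truncated" gauge transformed configuration A^{γ,2} is a polynomial of second order
in γ and its derivatives.»*; p.342 tl.5–7: *«Our initial axial field A has only nine scalar components since A₀ was
identically 0. We want that the special-gauge field A′ contains the usual twelve components. In fact one should have A′₀ =
∂₀^{γ,2} = ∂₀γ + (λ/2)[γ, ∂₀γ].»*; p.377 tl.22–23: *«by (infinitesimal) gauge invariance, there is no first order
dependence in γ»*; p.338 tl.42–46 and p.339 tl.2–3 (as quoted in `…MRS93TruncatedGaugeDefect`): *«This is also true for
the truncated versions of the gauge transformations introduced above: (A + B)^{γ,n} = A^{γ,n} + B^{rot γ,n}, (II.32b) where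
the index n means that the gauge transformation for A and the rotation for B are truncated at order n. The term B^{rot γ}
is the linear part in B of the gauge transformation B^γ. For example B^{rot γ,2} = B − λ[B, γ]. (II.32c)»*.

**Why.** `…MRS93TruncatedGaugeDefect` proved (IV.2) as POINTWISE identities between polynomials in the jets and declared
READING (J): «the position-space statement (IV.2) about `∫_Λ` of these densities for the smooth cut-off sample fields
(p.352 tl.26–27) follows by integrating the pointwise identities; no function space, torus or measure is typed in this
file (the integration of such jet identities over the flat torus is the business of `…MRS93PositionSpaceFields` §11)».
This file does that business, and a little more than integration: the printed `A′` is first built as an honest FIELD ON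
`Λ` by (II.6), and its 1-jet (values and honest partial derivatives along the coordinate circles, product rule included)
is PROVED to be gen 5's jet map `gaugeTrunc2` applied to the jets of `A` and `γ` — so that «F²(A′)» below is (II.1)–(II.2)
taken on the position-space field `A′` itself, not on a formal jet.

**What is typed here (namespace `PositionSpace`, continued; everything PROVED; zero `sorry`, zero named facts).**
* §1 calculus on `Λ`: `HasPartialAt.add`/`sub`/`mul`/`const_mul`/`sum` (sum, Leibniz and linearity rules for the honest
  `∂_μ` of `…PositionSpaceFields` §4), `hasPartialAt_field'`, `hasPartialAt_trigPoly'`, `hasPartialAt_pderiv_trigPoly`,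
  `pderiv_const_mul`.
* §2 **`truncField S λ A K γ̃ ν a x` = (II.6) LITERALLY in position space**: `A′^a_ν(x) = A^a_ν(x) + (D_νγ)^a(x) +
  (λ/2)Σ_{bc} ε_abc γ^b(x) ∂_νγ^c(x)` (the synthesised `A`, the position-space (II.5) `covDPos`, the printed wedge
  product); `continuous_truncField`; **`truncField_time`** (p.342 tl.5–7 for an axial `A`: `A′₀ = ∂₀γ + (λ/2)[γ, ∂₀γ]` —
  the three time components the axial `A` lacks); **`hasPartialAt_truncField`**/`pderiv_truncField` (its honest partial
  derivatives, by the product rule), `continuous_pderiv_truncField`; `truncJetAt` (the 1-jet of `A′` at `x`: real parts of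
  values and partial derivatives) and **`truncJetAt_eq`**: for real cut-off `A`, `γ` it IS `InfinitesimalGauge.gaugeTrunc2 λ
  (jetAt S A x) (gaugeJetAt K γ̃ x)` — gen 5's (II.6)-on-jets, whose derivative slot was DEFINED by the Leibniz rule, agrees
  with the derivatives of the actual field `A′`.
* §3 `truncAction S λ A K γ̃ := ¼∫_Λ Σ_{μνa}(F^a_μν(A′)(x))² d⁴x` — «F²(A′)», the action (II.2) of the position-space field
  `A′` with (II.1) on its jet (`truncAction_nonneg`); `fun_prop` leaves in two variables; continuity on `Λ` of the
  densities `Σ(F(A))²`, `Σ(F(A^{γ,2}))²`, `Σ(F(A′))²`, `M`, and joint continuity in `(λ, x)` ∕ `(t, x)` of gen 10's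
  cofactor densities `pairTerm`/`M2` ∕ `remT`.
* §4 **(IV.2) OVER `Λ`**: `integral_S0_eq` (`∫_Λ S₀(A) = ∫_Λ Σ(F(A^{γ,2}))² + ∫_Λ M(A, γ)` for axial cut-off `A`, jet form);
  **`action_eq_truncAction_add`** (`¼∫_Λ ΣF(A)² = F²(A′) + ¼∫_Λ M(A, γ)`, real cut-off `A`, `γ`); **`eqIV2_integral`** — THE
  DISPLAY AS PRINTED: for a real AXIAL cut-off `A` and a real cut-off `γ`,
  `Fsp S λ A + quadTime S A = truncAction S λ A K γ̃ + ¼∫_Λ M(A, γ) d⁴x`, i.e. «F²_sp(A) + ⟨A, p₀²A⟩ = F²(A′) + M(A, γ)» with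
  the tree's own `F_sp` (II.10) and `⟨A, p₀²A⟩` of gen 3 on the left ((II.9) `action_eq_quadTime_add_Fsp` +
  `action_eq_integral_curvature_jetAt` + gen 10's pointwise `eqIV2` + `truncJetAt_eq`); **`integral_defectM_eq`** («with
  at least two powers of λ»: `∫_Λ M = λ²∫_Λ M₂(λ)`), `continuous_integral_M2` (parametric integral over the compact `Λ`),
  **`integral_defectM_isBigO`** («M(A, γ) = O(λ²)» for the INTEGRATED defect: `(λ ↦ ∫_Λ M) =O[𝓝 0] (λ ↦ λ²)`).
* §5 «no first order dependence in γ» over `Λ`: `gaugeJetAt_smul` (the jet of `tγ` is `GaugeJet.smul t` of the jet of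
  `γ`), `integral_defectM_smul` (`∫_Λ M(A, tγ) = −t²∫_Λ R(t)`), `continuous_integral_remT`,
  **`hasDerivAt_integral_defectM_smul`** (`d/dt|₀ ∫_Λ M(A, tγ) d⁴x = 0`).
* §6 (IV.4)'s variables in position space: `coeff_add`, `field_add`, `pderiv_field_add`, **`jetAt_add`** (the jet of
  `A_s + B_l` is the sum of the jets), `isRealOn_add`; **`rotField`** = (II.32c) LITERALLY in position space (`B′^a_ν(x) =
  B^a_ν(x) − λΣ_{bc} ε_abc B^b_ν(x)γ^c(x)`), **`truncField_add`** ((II.32b) at `n = 2` for the fields: `(A_s + B_l)′ = A′_s +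
  B′_l`), `hasPartialAt_rotField`/`pderiv_rotField`, `rotJetAt` and **`rotJetAt_eq`** (the jet of `B′` IS gen 5's
  `InfinitesimalGauge.rotTrunc` on the jets, real `B`, `γ`), **`action_add_eq_integral`** ((IV.2) over `Λ` for the
  decomposed field: `¼∫_Λ ΣF(A_s + B_l)² = ¼∫_Λ ΣF(A′_s + B′_l)² + ¼∫_Λ M(A_s + B_l, γ)`, the primed fields entering through
  their honest jets).

**Readings (declared).** (P′)/(C′)/(W′)/(K) of `…MRS93PositionSpaceFields` (period `2π`, unit volume; coefficient
conventions; windows; Schwarz symmetry a theorem for cut-off `γ`); (N) of `…MRS93TruncatedGaugeDefect`: «F²», «F²_sp»,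
«⟨A, p₀²A⟩» in the normalisation of gen 3's `action = ¼Σ|F̃|² = ¼∫_Λ ΣF²`, `Fsp`, `quadTime` (READING (P) discharged there,
§7), and «M(A, γ)» read as `¼∫_Λ` of gen 10's density `defectM` accordingly — a common positive factor on both sides of
(IV.2) is not a statement. (T) the wedge-product sign is the print's (`TruncatedGauge.eps`), as in every MRS file.

**Honest status / what is NOT claimed.** The field `A′` is a trigonometric polynomial on `Λ` with, in general, a non-zero
time component (`truncField_time`) and a non-zero constant Fourier mode (`…PositionSpaceFields` §18, precision (aa):
already `A + tDγ` has one), so «F²(A′)» is NOT `MainStatement.action` of a configuration of the pinned (axial,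
zero-mode-deleted) carrier and is not claimed to be: it is defined directly by (II.1)–(II.2) on `A′`. (IV.2)'s ROLE (which
vertices of `M` are «dominable», pp.353–354; `M` «treated as an interaction») is analytic and untouched; nothing
instantiates (II.78)/(IV.1); nothing here is continuum YM₄ on `T⁴` without infrared cutoff, a mass gap, or Clay; nothing
of Bałaban's.
-/

noncomputable section

open MeasureTheory Finset Complex
open scoped ComplexConjugate

namespace Literature.MathematicalPhysics.QuantumFieldTheory.MagnenRivasseauSeneor1993

namespace PositionSpace

open MainStatement AxialWard InfinitesimalGauge SectIV TruncatedGaugeDefect Filter Topology Asymptotics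

variable (S : Finset Momentum)

/-- Every continuous real function on the (compact) position space is `vol`-integrable (private plumbing). [folklore] -/
private theorem integrable_volR {f : Pos → ℝ} (hf : Continuous f) : Integrable f vol := by
  obtain ⟨C, hC⟩ := isCompact_univ.exists_bound_of_continuousOn hf.continuousOn
  exact (integrable_const C).mono' hf.aestronglyMeasurable
    (Filter.Eventually.of_forall fun x => hC x (Set.mem_univ x))

/-! ## §1 Calculus on `Λ`: sum, product and linearity rules for the honest `∂_μ` -/

/-- Sum rule for `∂_μ` along a coordinate circle. [cite: MagnenRivasseauSeneor1993, (II.1) p.328 tl.28–30] -/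
theorem HasPartialAt.add {μ : Fin 4} {f g : Pos → ℂ} {f' g' : ℂ} {x : Pos} (hf : HasPartialAt μ f f' x)
    (hg : HasPartialAt μ g g' x) : HasPartialAt μ (fun y => f y + g y) (f' + g') x := by
  unfold HasPartialAt at hf hg ⊢
  exact hf.add hg

/-- Difference rule for `∂_μ`. [cite: MagnenRivasseauSeneor1993, (II.1) p.328 tl.28–30] -/
theorem HasPartialAt.sub {μ : Fin 4} {f g : Pos → ℂ} {f' g' : ℂ} {x : Pos} (hf : HasPartialAt μ f f' x)
    (hg : HasPartialAt μ g g' x) : HasPartialAt μ (fun y => f y - g y) (f' - g') x := by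
  unfold HasPartialAt at hf hg ⊢
  exact hf.sub hg

/-- **Leibniz rule for `∂_μ`** — the rule by which (II.6)'s `(λ/2)[γ, ∂_μγ]` and (II.5)'s `λ[A_μ, γ]` are differentiated
(«a polynomial of second order in γ and its derivatives»). [cite: MagnenRivasseauSeneor1993, (II.1) p.328 tl.28–30, (II.5)–(II.6) p.329 tl.10–18] -/
theorem HasPartialAt.mul {μ : Fin 4} {f g : Pos → ℂ} {f' g' : ℂ} {x : Pos} (hf : HasPartialAt μ f f' x)
    (hg : HasPartialAt μ g g' x) : HasPartialAt μ (fun y => f y * g y) (f' * g x + f x * g') x := by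
  unfold HasPartialAt at hf hg ⊢
  have h := hf.mul hg
  simp only [shift_zero] at h
  exact h

/-- Constant multiples. [cite: MagnenRivasseauSeneor1993, (II.1) p.328 tl.28–30] -/
theorem HasPartialAt.const_mul {μ : Fin 4} {f : Pos → ℂ} {f' : ℂ} {x : Pos} (c : ℂ) (hf : HasPartialAt μ f f' x) :
    HasPartialAt μ (fun y => c * f y) (c * f') x := by
  unfold HasPartialAt at hf ⊢
  exact hf.const_mul c

/-- Finite sums. [cite: MagnenRivasseauSeneor1993, (II.1) p.328 tl.28–30] -/
theorem HasPartialAt.sum {ι : Type*} {μ : Fin 4} (T : Finset ι) {f : ι → Pos → ℂ} {f' : ι → ℂ} {x : Pos}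
    (h : ∀ i ∈ T, HasPartialAt μ (f i) (f' i) x) : HasPartialAt μ (fun y => ∑ i ∈ T, f i y) (∑ i ∈ T, f' i) x := by
  unfold HasPartialAt at h ⊢
  exact HasDerivAt.fun_sum h

/-- `pderiv` of a constant multiple (unconditionally, field-valued). [cite: MagnenRivasseauSeneor1993, (II.1) p.328 tl.28–30] -/
theorem pderiv_const_mul (μ : Fin 4) (c : ℂ) (f : Pos → ℂ) (x : Pos) :
    pderiv μ (fun y => c * f y) x = c * pderiv μ f x := by
  unfold pderiv
  exact deriv_const_mul_field c

/-- `∂_μA^a_ν(x)` as an honest derivative, with value written `pderiv`. [cite: MagnenRivasseauSeneor1993, (II.1) p.328 tl.28–30] -/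
theorem hasPartialAt_field' (A : Config) (ν : Fin 4) (a : Fin 3) (μ : Fin 4) (x : Pos) :
    HasPartialAt μ (field S A ν a) (pderiv μ (field S A ν a) x) x := by
  rw [pderiv_field]
  exact hasPartialAt_field S A ν a μ x

/-- `∂_μP(x)` as an honest derivative, with value written `pderiv`. [cite: MagnenRivasseauSeneor1993, (II.1) p.328 tl.28–30] -/
theorem hasPartialAt_trigPoly' (K : Finset (Fin 4 → ℤ)) (c : (Fin 4 → ℤ) → ℂ) (μ : Fin 4) (x : Pos) :
    HasPartialAt μ (trigPoly K c) (pderiv μ (trigPoly K c) x) x := by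
  rw [pderiv_trigPoly]
  exact hasPartialAt_trigPoly K c μ x

/-- `∂_μ(∂_νP)(x)` as an honest derivative of the function `∂_νP`. [cite: MagnenRivasseauSeneor1993, (II.1) p.328 tl.28–30, (II.6) p.329 tl.16–18] -/
theorem hasPartialAt_pderiv_trigPoly (K : Finset (Fin 4 → ℤ)) (c : (Fin 4 → ℤ) → ℂ) (μ ν : Fin 4) (x : Pos) :
    HasPartialAt μ (pderiv ν (trigPoly K c)) (pderiv μ (pderiv ν (trigPoly K c)) x) x := by
  have e : pderiv ν (trigPoly K c) = trigPoly K (fun k => I * (k ν : ℂ) * c k) :=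
    funext fun y => pderiv_trigPoly K c ν y
  rw [e, pderiv_trigPoly]
  exact hasPartialAt_trigPoly K _ μ x

/-! ## §2 (II.6) in position space: the field `A′ = A^{γ,2}` on `Λ` and its 1-jet -/

/-- **(II.6) LITERALLY IN POSITION SPACE — the truncated gauge transform `A′ ≡ A^{γ,2}` as a field on `Λ`**:
`A′^a_ν(x) = A^a_ν(x) + (D_νγ)^a(x) + (λ/2) Σ_{bc} ε_abc γ^b(x) ∂_νγ^c(x)`, for the synthesised cut-off `A` (§5) and the cut-off
`γ^a = Σ_{k∈K} γ̃^a(k)e^{ik·x}` (§10), with the position-space (II.5) `covDPos` of §18. All twelve components `ν = 0,…,3`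
(p.342 tl.5–7). [cite: MagnenRivasseauSeneor1993, §II.A (II.6) p.329 tl.16–18; §II.E p.342 tl.5–7; §IV p.353 tl.3 («A′ ≡ A^{γ,2}»)] -/
def truncField (lam : ℝ) (A : Config) (K : Finset (Fin 4 → ℤ)) (d : Fin 3 → (Fin 4 → ℤ) → ℂ) (ν : Fin 4) (a : Fin 3)
    (x : Pos) : ℂ :=
  field S A ν a x + covDPos S lam A K d ν a x
    + ((lam / 2 : ℝ) : ℂ) * ∑ b, ∑ c, (TruncatedGauge.eps a b c : ℂ) * (trigPoly K (d b) x * pderiv ν (trigPoly K (d c)) x)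

/-- `A′` is continuous on `Λ` (a trigonometric polynomial — «the sample fields are smooth», p.352 tl.27).
[cite: MagnenRivasseauSeneor1993, §IV p.352 tl.26–27; §II.A (II.6) p.329] -/
theorem continuous_truncField (lam : ℝ) (A : Config) (K : Finset (Fin 4 → ℤ)) (d : Fin 3 → (Fin 4 → ℤ) → ℂ) (ν : Fin 4)
    (a : Fin 3) : Continuous (truncField S lam A K d ν a) := by
  unfold truncField
  exact ((continuous_field S A ν a).add (continuous_covDPos S lam A K d ν a)).add (continuous_const.mul
    (continuous_finsetSum _ fun b _ => continuous_finsetSum _ fun c _ =>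
      continuous_const.mul ((continuous_trigPoly K (d b)).mul (continuous_pderiv_trigPoly K (d c) ν 0).1)))

/-- **p.342 tl.5–7 «A′₀ = ∂₀^{γ,2} = ∂₀γ + (λ/2)[γ, ∂₀γ]» IN POSITION SPACE**: for an AXIAL configuration (`A₀ ≡ 0`) the time
component of `A′` is `∂₀γ^a(x) + (λ/2)Σ_{bc} ε_abc γ^b(x) ∂₀γ^c(x)` — the «ex nihilo» component (cf. `MainStatement.dTrunc2Coeff_eq`
in momentum space, `TruncatedGaugeDefect.gaugeTrunc2_val_time` on jets). [cite: MagnenRivasseauSeneor1993, §II.E p.342 tl.5–7, (II.47) p.342] -/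
theorem truncField_time (lam : ℝ) {A : Config} (hA : IsAxial A) (K : Finset (Fin 4 → ℤ)) (d : Fin 3 → (Fin 4 → ℤ) → ℂ)
    (a : Fin 3) (x : Pos) :
    truncField S lam A K d 0 a x = pderiv 0 (trigPoly K (d a)) x
      + ((lam / 2 : ℝ) : ℂ) * ∑ b, ∑ c, (TruncatedGauge.eps a b c : ℂ) * (trigPoly K (d b) x * pderiv 0 (trigPoly K (d c)) x) := by
  have h0 : ∀ b, field S A 0 b x = 0 := fun b => by simp [field, coeff_time hA]
  simp only [truncField, covDPos, h0, zero_mul, mul_zero, Finset.sum_const_zero, sub_zero, zero_add]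

/-- **THE HONEST PARTIAL DERIVATIVES OF `A′`** (product rule on the two commutator terms):
`∂_μA′^a_ν = ∂_μA^a_ν + (∂_μ∂_νγ^a − λΣε_abc(∂_μA^b_ν γ^c) − λΣε_abc(A^b_ν ∂_μγ^c)) + (λ/2)(Σε_abc ∂_μγ^b ∂_νγ^c + Σε_abc γ^b ∂_μ∂_νγ^c)`.
[cite: MagnenRivasseauSeneor1993, (II.1) p.328 tl.28–30, (II.5)–(II.6) p.329 tl.10–18] -/
theorem hasPartialAt_truncField (lam : ℝ) (A : Config) (K : Finset (Fin 4 → ℤ)) (d : Fin 3 → (Fin 4 → ℤ) → ℂ)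
    (μ ν : Fin 4) (a : Fin 3) (x : Pos) :
    HasPartialAt μ (truncField S lam A K d ν a)
      (pderiv μ (field S A ν a) x
        + (pderiv μ (pderiv ν (trigPoly K (d a))) x
          - (lam : ℂ) * ∑ b, ∑ c, (TruncatedGauge.eps a b c : ℂ) * (pderiv μ (field S A ν b) x * trigPoly K (d c) x)
          - (lam : ℂ) * ∑ b, ∑ c, (TruncatedGauge.eps a b c : ℂ) * (field S A ν b x * pderiv μ (trigPoly K (d c)) x))
        + ((lam / 2 : ℝ) : ℂ) * (∑ b, ∑ c, (TruncatedGauge.eps a b c : ℂ) *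
              (pderiv μ (trigPoly K (d b)) x * pderiv ν (trigPoly K (d c)) x)
            + ∑ b, ∑ c, (TruncatedGauge.eps a b c : ℂ) * (trigPoly K (d b) x * pderiv μ (pderiv ν (trigPoly K (d c))) x))) x := by
  have hF := fun b => hasPartialAt_field' S A ν b μ x
  have hP := fun c => hasPartialAt_trigPoly' K (d c) μ x
  have hdP := fun c => hasPartialAt_pderiv_trigPoly K (d c) μ ν x
  have h1 : HasPartialAt μ (fun y => ∑ b, ∑ c, (TruncatedGauge.eps a b c : ℂ) * (field S A ν b y * trigPoly K (d c) y))
      (∑ b, ∑ c, (TruncatedGauge.eps a b c : ℂ) *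
        (pderiv μ (field S A ν b) x * trigPoly K (d c) x + field S A ν b x * pderiv μ (trigPoly K (d c)) x)) x :=
    HasPartialAt.sum _ fun b _ => HasPartialAt.sum _ fun c _ => ((hF b).mul (hP c)).const_mul _
  have h2 : HasPartialAt μ
      (fun y => ∑ b, ∑ c, (TruncatedGauge.eps a b c : ℂ) * (trigPoly K (d b) y * pderiv ν (trigPoly K (d c)) y))
      (∑ b, ∑ c, (TruncatedGauge.eps a b c : ℂ) *
        (pderiv μ (trigPoly K (d b)) x * pderiv ν (trigPoly K (d c)) x
          + trigPoly K (d b) x * pderiv μ (pderiv ν (trigPoly K (d c))) x)) x :=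
    HasPartialAt.sum _ fun b _ => HasPartialAt.sum _ fun c _ => ((hP b).mul (hdP c)).const_mul _
  have hmid := (hdP a).sub (h1.const_mul (lam : ℂ))
  have h := ((hF a).add hmid).add (h2.const_mul ((lam / 2 : ℝ) : ℂ))
  have e1 : (lam : ℂ) * ∑ b, ∑ c, (TruncatedGauge.eps a b c : ℂ) *
        (pderiv μ (field S A ν b) x * trigPoly K (d c) x + field S A ν b x * pderiv μ (trigPoly K (d c)) x) =
      (lam : ℂ) * ∑ b, ∑ c, (TruncatedGauge.eps a b c : ℂ) * (pderiv μ (field S A ν b) x * trigPoly K (d c) x)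
        + (lam : ℂ) * ∑ b, ∑ c, (TruncatedGauge.eps a b c : ℂ) * (field S A ν b x * pderiv μ (trigPoly K (d c)) x) := by
    simp only [mul_add, Finset.sum_add_distrib]
  have e2 : ((lam / 2 : ℝ) : ℂ) * ∑ b, ∑ c, (TruncatedGauge.eps a b c : ℂ) *
        (pderiv μ (trigPoly K (d b)) x * pderiv ν (trigPoly K (d c)) x
          + trigPoly K (d b) x * pderiv μ (pderiv ν (trigPoly K (d c))) x) =
      ((lam / 2 : ℝ) : ℂ) * (∑ b, ∑ c, (TruncatedGauge.eps a b c : ℂ) *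
            (pderiv μ (trigPoly K (d b)) x * pderiv ν (trigPoly K (d c)) x)
          + ∑ b, ∑ c, (TruncatedGauge.eps a b c : ℂ) * (trigPoly K (d b) x * pderiv μ (pderiv ν (trigPoly K (d c))) x)) := by
    simp only [mul_add, Finset.sum_add_distrib]
  rw [e1, ← sub_sub] at h
  rw [e2] at h
  exact h

/-- … and so `pderiv μ` of `A′^a_ν` is that expression. [cite: MagnenRivasseauSeneor1993, (II.1) p.328 tl.28–30, (II.5)–(II.6) p.329 tl.10–18] -/
theorem pderiv_truncField (lam : ℝ) (A : Config) (K : Finset (Fin 4 → ℤ)) (d : Fin 3 → (Fin 4 → ℤ) → ℂ)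
    (μ ν : Fin 4) (a : Fin 3) (x : Pos) :
    pderiv μ (truncField S lam A K d ν a) x =
      pderiv μ (field S A ν a) x
        + (pderiv μ (pderiv ν (trigPoly K (d a))) x
          - (lam : ℂ) * ∑ b, ∑ c, (TruncatedGauge.eps a b c : ℂ) * (pderiv μ (field S A ν b) x * trigPoly K (d c) x)
          - (lam : ℂ) * ∑ b, ∑ c, (TruncatedGauge.eps a b c : ℂ) * (field S A ν b x * pderiv μ (trigPoly K (d c)) x))
        + ((lam / 2 : ℝ) : ℂ) * (∑ b, ∑ c, (TruncatedGauge.eps a b c : ℂ) *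
              (pderiv μ (trigPoly K (d b)) x * pderiv ν (trigPoly K (d c)) x)
            + ∑ b, ∑ c, (TruncatedGauge.eps a b c : ℂ) * (trigPoly K (d b) x * pderiv μ (pderiv ν (trigPoly K (d c))) x)) :=
  (hasPartialAt_truncField S lam A K d μ ν a x).pderiv_eq

/-- `x ↦ ∂_μA′^a_ν(x)` is continuous on `Λ`. [cite: MagnenRivasseauSeneor1993, §IV p.352 tl.26–27; (II.6) p.329] -/
theorem continuous_pderiv_truncField (lam : ℝ) (A : Config) (K : Finset (Fin 4 → ℤ)) (d : Fin 3 → (Fin 4 → ℤ) → ℂ)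
    (μ ν : Fin 4) (a : Fin 3) : Continuous fun x => pderiv μ (truncField S lam A K d ν a) x := by
  simp_rw [pderiv_truncField]
  have hF := fun b => continuous_pderiv_field S A ν b μ
  have hA := fun b => continuous_field S A ν b
  have hP := fun c => continuous_trigPoly K (d c)
  have hP1 := fun c (κ : Fin 4) => (continuous_pderiv_trigPoly K (d c) κ 0).1
  have hP2 := fun c => (continuous_pderiv_trigPoly K (d c) μ ν).2
  refine ((hF a).add (((hP2 a).sub (continuous_const.mul (continuous_finsetSum _ fun b _ => continuous_finsetSum _
    fun c _ => continuous_const.mul ((hF b).mul (hP c))))).sub (continuous_const.mul (continuous_finsetSum _ fun b _ =>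
    continuous_finsetSum _ fun c _ => continuous_const.mul ((hA b).mul (hP1 c μ)))))).add (continuous_const.mul
    ((continuous_finsetSum _ fun b _ => continuous_finsetSum _ fun c _ => continuous_const.mul ((hP1 b μ).mul (hP1 c ν))).add
    (continuous_finsetSum _ fun b _ => continuous_finsetSum _ fun c _ => continuous_const.mul ((hP b).mul (hP2 c)))))

/-- **THE 1-JET OF `A′` AT `x`**: values `Re A′^a_ν(x)` and honest first partial derivatives `Re ∂_μA′^a_ν(x)` (for real `A`, `γ`
these ARE the values), in the format `SectIV.FieldJet` on which (II.1) `SectIV.curvature` acts.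
[cite: MagnenRivasseauSeneor1993, (II.1) p.328 tl.28–30, (II.6) p.329 tl.16–18; §IV (IV.2) p.353] -/
def truncJetAt (lam : ℝ) (A : Config) (K : Finset (Fin 4 → ℤ)) (d : Fin 3 → (Fin 4 → ℤ) → ℂ) (x : Pos) :
    SectIV.FieldJet where
  val ν a := (truncField S lam A K d ν a x).re
  der μ ν a := (pderiv μ (truncField S lam A K d ν a) x).re

/-- `(truncJetAt …).val` unfolds. [cite: MagnenRivasseauSeneor1993, (II.6) p.329 tl.16–18] -/
theorem truncJetAt_val (lam : ℝ) (A : Config) (K : Finset (Fin 4 → ℤ)) (d : Fin 3 → (Fin 4 → ℤ) → ℂ) (x : Pos) (ν : Fin 4)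
    (a : Fin 3) : (truncJetAt S lam A K d x).val ν a = (truncField S lam A K d ν a x).re := rfl

/-- `(truncJetAt …).der` unfolds. [cite: MagnenRivasseauSeneor1993, (II.6) p.329 tl.16–18] -/
theorem truncJetAt_der (lam : ℝ) (A : Config) (K : Finset (Fin 4 → ℤ)) (d : Fin 3 → (Fin 4 → ℤ) → ℂ) (x : Pos)
    (μ ν : Fin 4) (a : Fin 3) : (truncJetAt S lam A K d x).der μ ν a = (pderiv μ (truncField S lam A K d ν a) x).re := rfl

/-- **THE JET OF THE POSITION-SPACE `A′` IS GEN 5's (II.6)-ON-JETS**: for a real cut-off configuration `A` and a real cut-off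
`γ`, `truncJetAt S λ A K γ̃ x = InfinitesimalGauge.gaugeTrunc2 λ (jetAt S A x) (gaugeJetAt K γ̃ x)` — values by (II.6), and the
DERIVATIVE slot of `gaugeTrunc2` (defined in `…InfinitesimalGauge` by the Leibniz rule: `∂_μ(D_νγ) = ∂_μ∂_νγ − λ[∂_μA_ν, γ] −
λ[A_ν, ∂_μγ]`, `∂_μ((λ/2)[γ, ∂_νγ]) = (λ/2)([∂_μγ, ∂_νγ] + [γ, ∂_μ∂_νγ])`) coincides with the honest partial derivatives of `A′`.
[cite: MagnenRivasseauSeneor1993, (II.1) p.328 tl.28–30, (II.5)–(II.6) p.329 tl.10–18; §IV (IV.2) p.353 tl.3] -/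
theorem truncJetAt_eq (lam : ℝ) {S : Finset Momentum} {A : Config} (hA : IsRealOn S A) {K : Finset (Fin 4 → ℤ)}
    {d : Fin 3 → (Fin 4 → ℤ) → ℂ} (hd : ∀ a, RealCoeff K (d a)) (x : Pos) :
    truncJetAt S lam A K d x = gaugeTrunc2 lam (jetAt S A x) (gaugeJetAt K d x) := by
  have hA0 : ∀ ν b, (field S A ν b x).im = 0 := fun ν b => field_im hA ν b x
  have hA1 : ∀ ν b μ, (pderiv μ (field S A ν b) x).im = 0 := fun ν b μ => pderiv_field_im hA ν b μ x
  have hP0 : ∀ c, (trigPoly K (d c) x).im = 0 := fun c => trigPoly_im (hd c) x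
  have hP1 : ∀ c μ, (pderiv μ (trigPoly K (d c)) x).im = 0 := fun c μ => (pderiv_trigPoly_im (hd c) μ 0 x).1
  have hP2 : ∀ c μ ν, (pderiv μ (pderiv ν (trigPoly K (d c))) x).im = 0 := fun c μ ν => (pderiv_trigPoly_im (hd c) μ ν x).2
  refine SectIV.FieldJet.ext' (fun ν => funext fun a => ?_) (fun μ ν => funext fun a => ?_)
  · rw [truncJetAt_val]
    simp only [gaugeTrunc2, truncField, Pi.add_apply, Pi.smul_apply, smul_eq_mul, jetAt_val, gaugeJetAt_val,
      gaugeJetAt_der, TruncatedGauge.bracket, covD_jetAt_eq_re lam hA hd, Complex.add_re, Complex.ofReal_re,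
      Complex.ofReal_im, Complex.re_sum, Complex.mul_re, hP0, hP1, mul_zero, zero_mul, sub_zero]
    simp only [mul_assoc]
  · rw [truncJetAt_der, pderiv_truncField]
    simp only [gaugeTrunc2, covDDer, Pi.add_apply, Pi.sub_apply, Pi.smul_apply, smul_eq_mul, jetAt_val, jetAt_der,
      gaugeJetAt_val, gaugeJetAt_der, gaugeJetAt_der2, TruncatedGauge.bracket, Complex.add_re, Complex.sub_re,
      Complex.ofReal_re, Complex.ofReal_im, Complex.re_sum, Complex.mul_re, hA0, hA1, hP0, hP1, hP2, mul_zero, zero_mul,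
      sub_zero]
    simp only [mul_assoc]

/-! ## §3 «F²(A′)» and the continuity of the (IV.2) densities on `Λ` -/

/-- Leaf lemma for `fun_prop` in two variables: `(λ, x) ↦ Re A^a_μ(x)`. [cite: MagnenRivasseauSeneor1993, (II.1) p.328 tl.28–30] -/
@[fun_prop]
theorem continuous_field_re_snd (A : Config) (μ : Fin 4) (a : Fin 3) :
    Continuous fun p : ℝ × Pos => (field S A μ a p.2).re :=
  (continuous_field_re S A μ a).comp continuous_snd

/-- Leaf lemma for `fun_prop` in two variables: `(λ, x) ↦ Re ∂_νA^a_μ(x)`. [cite: MagnenRivasseauSeneor1993, (II.1) p.328 tl.28–30] -/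
@[fun_prop]
theorem continuous_pderiv_field_re_snd (A : Config) (μ : Fin 4) (a : Fin 3) (ν : Fin 4) :
    Continuous fun p : ℝ × Pos => (pderiv ν (field S A μ a) p.2).re :=
  (continuous_pderiv_field_re S A μ a ν).comp continuous_snd

/-- Leaf lemma for `fun_prop` in two variables: `(λ, x) ↦ Re P(x)`. [cite: MagnenRivasseauSeneor1993, (II.1) p.328 tl.28–30] -/
@[fun_prop]
theorem continuous_trigPoly_re_snd (K : Finset (Fin 4 → ℤ)) (d : (Fin 4 → ℤ) → ℂ) :
    Continuous fun p : ℝ × Pos => (trigPoly K d p.2).re :=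
  (continuous_trigPoly_re K d).comp continuous_snd

/-- Leaf lemma for `fun_prop` in two variables: `(λ, x) ↦ Re ∂_μP(x)`. [cite: MagnenRivasseauSeneor1993, (II.1) p.328 tl.28–30] -/
@[fun_prop]
theorem continuous_pderiv_trigPoly_re_snd (K : Finset (Fin 4 → ℤ)) (d : (Fin 4 → ℤ) → ℂ) (μ : Fin 4) :
    Continuous fun p : ℝ × Pos => (pderiv μ (trigPoly K d) p.2).re :=
  (continuous_pderiv_trigPoly_re K d μ).comp continuous_snd

/-- Leaf lemma for `fun_prop` in two variables: `(λ, x) ↦ Re ∂_μ∂_νP(x)`. [cite: MagnenRivasseauSeneor1993, (II.1) p.328 tl.28–30] -/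
@[fun_prop]
theorem continuous_pderiv_pderiv_trigPoly_re_snd (K : Finset (Fin 4 → ℤ)) (d : (Fin 4 → ℤ) → ℂ) (μ ν : Fin 4) :
    Continuous fun p : ℝ × Pos => (pderiv μ (pderiv ν (trigPoly K d)) p.2).re :=
  (continuous_pderiv_pderiv_trigPoly_re K d μ ν).comp continuous_snd


/-- **«F²(A′)» — the action (II.2) of the position-space field `A′ = A^{γ,2}`**: `¼∫_Λ Σ_{μ,ν,a}(F^a_μν(A′)(x))² d⁴x` with
`F(A′)` the pointwise (II.1) `SectIV.curvature` on the 1-jet of `A′` (as §9 `action_eq_integral_curvature_jetAt` reads the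
tree's `action` for `A`). [cite: MagnenRivasseauSeneor1993, (II.1)–(II.2) p.328 tl.28–35; §IV (IV.2) p.353 tl.4–5 («F²(A′)»)] -/
def truncAction (lam : ℝ) (A : Config) (K : Finset (Fin 4 → ℤ)) (d : Fin 3 → (Fin 4 → ℤ) → ℂ) : ℝ :=
  (1 / 4) * ∫ x, fieldStrengthSq lam (truncJetAt S lam A K d x) ∂vol

/-- `0 ≤ F²(A′)`. [cite: MagnenRivasseauSeneor1993, (II.2) p.328; §IV (IV.2) p.353] -/
theorem truncAction_nonneg (lam : ℝ) (A : Config) (K : Finset (Fin 4 → ℤ)) (d : Fin 3 → (Fin 4 → ℤ) → ℂ) :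
    0 ≤ truncAction S lam A K d :=
  mul_nonneg (by norm_num) (integral_nonneg fun x => fieldStrengthSq_nonneg lam _)

/-- The action density `Σ(F(A))²` is continuous on `Λ` along the jets of a cut-off field. [cite: MagnenRivasseauSeneor1993, (II.1)–(II.2) p.328; §IV p.352 tl.26–27] -/
theorem continuous_fieldStrengthSq_jetAt (lam : ℝ) (A : Config) :
    Continuous fun x => fieldStrengthSq lam (jetAt S A x) := by
  simp only [fieldStrengthSq, curvature, TruncatedGauge.bracket, Pi.sub_apply, Pi.smul_apply, smul_eq_mul, jetAt_val,
    jetAt_der]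
  fun_prop

/-- The density `Σ(F(A^{γ,2}))²` is continuous on `Λ` along the jets of cut-off `A`, `γ`. [cite: MagnenRivasseauSeneor1993, §IV (IV.2) p.353, p.352 tl.26–27] -/
theorem continuous_fieldStrengthSq_gaugeTrunc2_jetAt (lam : ℝ) (A : Config) (K : Finset (Fin 4 → ℤ))
    (d : Fin 3 → (Fin 4 → ℤ) → ℂ) :
    Continuous fun x => fieldStrengthSq lam (gaugeTrunc2 lam (jetAt S A x) (gaugeJetAt K d x)) := by
  simp only [fieldStrengthSq, curvature, gaugeTrunc2, covD, covDDer, TruncatedGauge.bracket, Pi.add_apply, Pi.sub_apply,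
    Pi.smul_apply, smul_eq_mul, jetAt_val, jetAt_der, gaugeJetAt_val, gaugeJetAt_der, gaugeJetAt_der2]
  fun_prop

/-- The density `Σ(F(A′))²` of `truncAction` is continuous on `Λ` (real cut-off `A`, `γ`). [cite: MagnenRivasseauSeneor1993, §IV (IV.2) p.353, p.352 tl.26–27] -/
theorem continuous_fieldStrengthSq_truncJetAt (lam : ℝ) {S : Finset Momentum} {A : Config} (hA : IsRealOn S A)
    {K : Finset (Fin 4 → ℤ)} {d : Fin 3 → (Fin 4 → ℤ) → ℂ} (hd : ∀ a, RealCoeff K (d a)) :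
    Continuous fun x => fieldStrengthSq lam (truncJetAt S lam A K d x) := by
  simp_rw [truncJetAt_eq lam hA hd]
  exact continuous_fieldStrengthSq_gaugeTrunc2_jetAt S lam A K d

/-- The defect density `M(A, γ)(x)` is continuous on `Λ`. [cite: MagnenRivasseauSeneor1993, §IV (IV.2) p.353, p.352 tl.26–27] -/
theorem continuous_defectM_jetAt (lam : ℝ) (A : Config) (K : Finset (Fin 4 → ℤ)) (d : Fin 3 → (Fin 4 → ℤ) → ℂ) :
    Continuous fun x => defectM lam (jetAt S A x) (gaugeJetAt K d x) := by
  unfold defectM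
  exact (continuous_fieldStrengthSq_jetAt S lam A).sub (continuous_fieldStrengthSq_gaugeTrunc2_jetAt S lam A K d)

/-- The per-pair cofactor `pairTerm` of gen 10 is JOINTLY continuous in `(λ, x)` along the jets. [cite: MagnenRivasseauSeneor1993, §IV (IV.2) p.353] -/
theorem continuous_pairTerm_jetAt_uncurry (A : Config) (K : Finset (Fin 4 → ℤ)) (d : Fin 3 → (Fin 4 → ℤ) → ℂ)
    (μ ν : Fin 4) : Continuous fun p : ℝ × Pos => pairTerm p.1 (jetAt S A p.2) (gaugeJetAt K d p.2) μ ν := by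
  simp only [pairTerm, qTerm, xTerm, curvature, TruncatedGauge.bracket, Pi.add_apply, Pi.sub_apply, Pi.neg_apply,
    Pi.smul_apply, smul_eq_mul, jetAt_val, jetAt_der, gaugeJetAt_val, gaugeJetAt_der]
  fun_prop

/-- `M₂(λ)(x)` is jointly continuous in `(λ, x)`. [cite: MagnenRivasseauSeneor1993, §IV (IV.2) p.353] -/
theorem continuous_M2_jetAt_uncurry (A : Config) (K : Finset (Fin 4 → ℤ)) (d : Fin 3 → (Fin 4 → ℤ) → ℂ) :
    Continuous fun p : ℝ × Pos => M2 p.1 (jetAt S A p.2) (gaugeJetAt K d p.2) := by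
  unfold M2
  exact (continuous_finsetSum _ fun μ _ => continuous_finsetSum _ fun ν _ =>
    continuous_pairTerm_jetAt_uncurry S A K d μ ν).neg

/-- The `t²`-cofactor `R(t)(x)` of gen 10's `γ`-expansion is jointly continuous in `(t, x)`. [cite: MagnenRivasseauSeneor1993, §IV (IV.2) p.353; §VIII (VIII.2) p.377 tl.22–23] -/
theorem continuous_remT_jetAt_uncurry (lam : ℝ) (A : Config) (K : Finset (Fin 4 → ℤ)) (d : Fin 3 → (Fin 4 → ℤ) → ℂ) :
    Continuous fun p : ℝ × Pos => remT lam (jetAt S A p.2) (gaugeJetAt K d p.2) p.1 := by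
  unfold remT
  refine continuous_finsetSum _ fun μ _ => continuous_finsetSum _ fun ν _ => ?_
  simp only [pairTermT, qqTerm, xTerm1, xTerm2, curvature, TruncatedGauge.bracket, Pi.add_apply, Pi.sub_apply,
    Pi.neg_apply, Pi.smul_apply, smul_eq_mul, jetAt_val, jetAt_der, gaugeJetAt_val, gaugeJetAt_der]
  fun_prop

/-! ## §4 (IV.2) over `Λ` -/

/-- **(IV.2) OVER `Λ`, JET FORM** (axial cut-off `A`, any cut-off `γ`; no reality hypothesis): `∫_Λ S₀(A) d⁴x =
∫_Λ Σ(F(A^{γ,2}))² d⁴x + ∫_Λ M(A, γ) d⁴x` — gen 10's pointwise `eqIV2_axial` integrated, every density being continuous on the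
compact `Λ`. [cite: MagnenRivasseauSeneor1993, §IV (IV.2) p.353 tl.2–5, p.352 tl.26–27; (II.9)–(II.10) p.330] -/
theorem integral_S0_eq (lam : ℝ) {A : Config} (hA : IsAxial A) (K : Finset (Fin 4 → ℤ)) (d : Fin 3 → (Fin 4 → ℤ) → ℂ) :
    ∫ x, S0 lam (jetAt S A x) ∂vol =
      (∫ x, fieldStrengthSq lam (gaugeTrunc2 lam (jetAt S A x) (gaugeJetAt K d x)) ∂vol)
        + ∫ x, defectM lam (jetAt S A x) (gaugeJetAt K d x) ∂vol := by
  have hpt : ∀ x, S0 lam (jetAt S A x) =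
      fieldStrengthSq lam (gaugeTrunc2 lam (jetAt S A x) (gaugeJetAt K d x)) + defectM lam (jetAt S A x) (gaugeJetAt K d x) :=
    fun x => eqIV2_axial lam (isAxialJet_jetAt S hA x) (gaugeJetAt K d x)
  simp_rw [hpt]
  exact integral_add (integrable_volR (continuous_fieldStrengthSq_gaugeTrunc2_jetAt S lam A K d))
    (integrable_volR (continuous_defectM_jetAt S lam A K d))

/-- **`¼∫_Λ ΣF(A)² = F²(A′) + ¼∫_Λ M(A, γ)`** for a real cut-off configuration `A` and a real cut-off `γ`: the tree's action (II.2)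
of `A` equals the action of the position-space field `A′ = A^{γ,2}` plus the integrated defect (gen 10's `eqIV2` at each point,
`truncJetAt_eq`, §9 `action_eq_integral_curvature_jetAt`). [cite: MagnenRivasseauSeneor1993, §IV (IV.2) p.353 tl.2–5; (II.2) p.328 tl.34–35] -/
theorem action_eq_truncAction_add (lam : ℝ) {S : Finset Momentum} {A : Config} (hA : IsRealOn S A)
    {K : Finset (Fin 4 → ℤ)} {d : Fin 3 → (Fin 4 → ℤ) → ℂ} (hd : ∀ a, RealCoeff K (d a)) :
    action S lam A = truncAction S lam A K d + (1 / 4) * ∫ x, defectM lam (jetAt S A x) (gaugeJetAt K d x) ∂vol := by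
  rw [action_eq_integral_curvature_jetAt hA lam, truncAction]
  have hpt : ∀ x, ∑ μ, ∑ ν, ∑ a, SectIV.curvature lam (jetAt S A x) μ ν a ^ 2 =
      fieldStrengthSq lam (truncJetAt S lam A K d x) + defectM lam (jetAt S A x) (gaugeJetAt K d x) := fun x => by
    rw [truncJetAt_eq lam hA hd x]
    exact eqIV2 lam (jetAt S A x) (gaugeJetAt K d x)
  simp_rw [hpt]
  rw [integral_add (integrable_volR (continuous_fieldStrengthSq_truncJetAt lam hA hd))
    (integrable_volR (continuous_defectM_jetAt S lam A K d)), mul_add]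

/-- **(IV.2) AS PRINTED, OVER `Λ`: «F²_sp(A) + ⟨A, p₀²A⟩ = F²(A′) + M(A, γ)»** — for a real AXIAL cut-off configuration `A` and a
real cut-off `γ`, with the tree's own spatial action `F_sp` (II.10) and `⟨A, p₀²A⟩` of `…MRS93AxialYMAction` on the left,
«F²(A′)» the action of the position-space field `A′ = A^{γ,2}`, and «M(A, γ)» the integrated defect `¼∫_Λ M`:
`Fsp S λ A + quadTime S A = truncAction S λ A K γ̃ + ¼∫_Λ M(A, γ)(x) d⁴x` ((II.9) `action_eq_quadTime_add_Fsp` and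
`action_eq_truncAction_add`). [cite: MagnenRivasseauSeneor1993, §IV (IV.2) p.353 tl.2–5; (II.9)–(II.10) p.330 tl.6–10; (II.2) p.328 tl.34–35] -/
theorem eqIV2_integral (lam : ℝ) {S : Finset Momentum} {A : Config} (hA : IsRealOn S A) (hAx : IsAxial A)
    {K : Finset (Fin 4 → ℤ)} {d : Fin 3 → (Fin 4 → ℤ) → ℂ} (hd : ∀ a, RealCoeff K (d a)) :
    Fsp S lam A + quadTime S A =
      truncAction S lam A K d + (1 / 4) * ∫ x, defectM lam (jetAt S A x) (gaugeJetAt K d x) ∂vol := by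
  rw [add_comm (Fsp S lam A), ← action_eq_quadTime_add_Fsp S hAx lam]
  exact action_eq_truncAction_add lam hA hd

/-- **«with at least two powers of λ», OVER `Λ`**: `∫_Λ M(A, γ) d⁴x = λ²·∫_Λ M₂(λ, A, γ) d⁴x` with gen 10's explicit cofactor
density `M2` (cut-off `γ` has Schwarz-symmetric jets, §10). [cite: MagnenRivasseauSeneor1993, §IV (IV.2) p.353 tl.2–5] -/
theorem integral_defectM_eq (lam : ℝ) (A : Config) (K : Finset (Fin 4 → ℤ)) (d : Fin 3 → (Fin 4 → ℤ) → ℂ) :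
    ∫ x, defectM lam (jetAt S A x) (gaugeJetAt K d x) ∂vol = lam ^ 2 * ∫ x, M2 lam (jetAt S A x) (gaugeJetAt K d x) ∂vol := by
  have h : ∀ x, defectM lam (jetAt S A x) (gaugeJetAt K d x) = lam ^ 2 * M2 lam (jetAt S A x) (gaugeJetAt K d x) :=
    fun x => defectM_eq lam _ (gaugeJetAt_symm K d x)
  simp_rw [h]
  exact integral_const_mul _ _

/-- `λ ↦ ∫_Λ M₂(λ, A, γ) d⁴x` is continuous (parametric integral of a jointly continuous density over the compact `Λ`).
[cite: MagnenRivasseauSeneor1993, §IV (IV.2) p.353, p.352 tl.26–27] -/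
theorem continuous_integral_M2 (A : Config) (K : Finset (Fin 4 → ℤ)) (d : Fin 3 → (Fin 4 → ℤ) → ℂ) :
    Continuous fun lam : ℝ => ∫ x, M2 lam (jetAt S A x) (gaugeJetAt K d x) ∂vol := by
  have h := continuous_parametric_integral_of_continuous (μ := vol)
    (f := fun (lam : ℝ) (x : Pos) => M2 lam (jetAt S A x) (gaugeJetAt K d x))
    (continuous_M2_jetAt_uncurry S A K d) isCompact_univ
  simpa only [Measure.restrict_univ] using h

/-- **«M(A, γ) = O(λ²)» FOR THE INTEGRATED DEFECT**: `(λ ↦ ∫_Λ M(A, γ) d⁴x) =O[𝓝 0] (λ ↦ λ²)` at fixed cut-off `A`, `γ` (the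
printed regime «as λ → 0», p.329 tl.15). [cite: MagnenRivasseauSeneor1993, §IV (IV.2) p.353 tl.4–5; §II.A p.329 tl.15] -/
theorem integral_defectM_isBigO (A : Config) (K : Finset (Fin 4 → ℤ)) (d : Fin 3 → (Fin 4 → ℤ) → ℂ) :
    (fun lam => ∫ x, defectM lam (jetAt S A x) (gaugeJetAt K d x) ∂vol) =O[𝓝 0] fun lam => lam ^ 2 := by
  have h1 : (fun lam => ∫ x, M2 lam (jetAt S A x) (gaugeJetAt K d x) ∂vol) =O[𝓝 0] fun _ => (1 : ℝ) :=
    ((continuous_integral_M2 S A K d).tendsto 0).isBigO_one ℝ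
  have h2 := (isBigO_refl (fun lam : ℝ => lam ^ 2) (𝓝 0)).mul h1
  simp only [mul_one] at h2
  refine h2.congr' (Eventually.of_forall fun lam => ?_) EventuallyEq.rfl
  exact (integral_defectM_eq S lam A K d).symm

/-! ## §5 «no first order dependence in γ» over `Λ` -/

/-- The cut-off `tγ` (coefficients scaled by `t`) has jet `GaugeJet.smul t` of the jet of `γ` — gen 10's scaling line on jets
is the scaling of the actual field. [cite: MagnenRivasseauSeneor1993, §II.A (II.5)–(II.6) p.329; §VIII (VIII.2) p.377 tl.22–23] -/
theorem gaugeJetAt_smul (K : Finset (Fin 4 → ℤ)) (d : Fin 3 → (Fin 4 → ℤ) → ℂ) (t : ℝ) (x : Pos) :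
    gaugeJetAt K (fun a k => (t : ℂ) * d a k) x = GaugeJet.smul t (gaugeJetAt K d x) := by
  have e : ∀ a, trigPoly K (fun k => (t : ℂ) * d a k) = fun y => (t : ℂ) * trigPoly K (d a) y := fun a => by
    funext y
    simp only [trigPoly, Finset.mul_sum, mul_assoc]
  have e1 : ∀ a (ν : Fin 4), pderiv ν (fun y => (t : ℂ) * trigPoly K (d a) y) = fun y => (t : ℂ) * pderiv ν (trigPoly K (d a)) y :=
    fun a ν => funext fun y => pderiv_const_mul ν (t : ℂ) _ y
  simp only [gaugeJetAt, GaugeJet.smul, e, e1, pderiv_const_mul, Complex.re_ofReal_mul]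
  rfl

/-- **`∫_Λ M(A, tγ) d⁴x = −t²·∫_Λ R(t) d⁴x`** (gen 10's `defectM_smul_eq` integrated). [cite: MagnenRivasseauSeneor1993, §IV (IV.2) p.353; §VIII (VIII.2) p.377 tl.22–23] -/
theorem integral_defectM_smul (lam : ℝ) (A : Config) (K : Finset (Fin 4 → ℤ)) (d : Fin 3 → (Fin 4 → ℤ) → ℂ) (t : ℝ) :
    ∫ x, defectM lam (jetAt S A x) (GaugeJet.smul t (gaugeJetAt K d x)) ∂vol =
      -(t ^ 2 * ∫ x, remT lam (jetAt S A x) (gaugeJetAt K d x) t ∂vol) := by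
  have h : ∀ x, defectM lam (jetAt S A x) (GaugeJet.smul t (gaugeJetAt K d x)) =
      -(t ^ 2 * remT lam (jetAt S A x) (gaugeJetAt K d x) t) := fun x => defectM_smul_eq lam _ (gaugeJetAt_symm K d x) t
  simp_rw [h, integral_neg, integral_const_mul]

/-- `t ↦ ∫_Λ R(t) d⁴x` is continuous (parametric integral over the compact `Λ`). [cite: MagnenRivasseauSeneor1993, §IV (IV.2) p.353, p.352 tl.26–27] -/
theorem continuous_integral_remT (lam : ℝ) (A : Config) (K : Finset (Fin 4 → ℤ)) (d : Fin 3 → (Fin 4 → ℤ) → ℂ) :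
    Continuous fun t : ℝ => ∫ x, remT lam (jetAt S A x) (gaugeJetAt K d x) t ∂vol := by
  have h := continuous_parametric_integral_of_continuous (μ := vol)
    (f := fun (t : ℝ) (x : Pos) => remT lam (jetAt S A x) (gaugeJetAt K d x) t)
    (continuous_remT_jetAt_uncurry S lam A K d) isCompact_univ
  simpa only [Measure.restrict_univ] using h

/-- **«NO FIRST ORDER DEPENDENCE IN γ» FOR THE INTEGRATED DEFECT**: `d/dt|_{t=0} ∫_Λ M(A, tγ) d⁴x = 0` for cut-off `A`, `γ` — the
integrated (IV.2) defect starts at second order in `γ` (this theorem) as well as at second order in `λ` (`integral_defectM_eq`).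
[cite: MagnenRivasseauSeneor1993, §IV (IV.2) p.353 tl.2–5; §VIII (VIII.2) p.377 tl.22–23] -/
theorem hasDerivAt_integral_defectM_smul (lam : ℝ) (A : Config) (K : Finset (Fin 4 → ℤ)) (d : Fin 3 → (Fin 4 → ℤ) → ℂ) :
    HasDerivAt (fun t => ∫ x, defectM lam (jetAt S A x) (GaugeJet.smul t (gaugeJetAt K d x)) ∂vol) 0 0 := by
  have hg : ContinuousAt (fun t => -∫ x, remT lam (jetAt S A x) (gaugeJetAt K d x) t ∂vol) 0 :=
    (continuous_integral_remT S lam A K d).neg.continuousAt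
  have h := hasDerivAt_const_add_sq_mul_of_continuousAt hg 0
  refine h.congr_of_eventuallyEq (Eventually.of_forall fun t => ?_)
  show ∫ x, defectM lam (jetAt S A x) (GaugeJet.smul t (gaugeJetAt K d x)) ∂vol =
    0 + t ^ 2 * -∫ x, remT lam (jetAt S A x) (gaugeJetAt K d x) t ∂vol
  rw [integral_defectM_smul]
  ring

/-! ## §6 (IV.4)'s variables in position space: the decomposed field `A = A_s + B_l` and the rotated background
`B′_l = B_l^{rot γ,2}` of (II.32c) -/

/-- Fourier coefficients are additive in the configuration. [cite: MagnenRivasseauSeneor1993, §II.C (II.32a) p.338 tl.40–41 («A + B»)] -/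
theorem coeff_add (A B : Config) (p : Momentum) (μ : Fin 4) (a : Fin 3) :
    coeff (A + B) p μ a = coeff A p μ a + coeff B p μ a := by
  simp only [coeff, Pi.add_apply, Complex.ofReal_add]
  ring

/-- The synthesis is additive: the position-space field of `A_s + B_l` is the sum of the two fields.
[cite: MagnenRivasseauSeneor1993, §II.C (II.32a)–(II.32b) p.338 tl.40–46] -/
theorem field_add (A B : Config) (μ : Fin 4) (a : Fin 3) (x : Pos) :
    field S (A + B) μ a x = field S A μ a x + field S B μ a x := by
  simp only [field, coeff_add, add_mul, Finset.sum_add_distrib]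

/-- … and so are its partial derivatives. [cite: MagnenRivasseauSeneor1993, §II.C (II.32a)–(II.32b) p.338 tl.40–46] -/
theorem pderiv_field_add (A B : Config) (μ : Fin 4) (a : Fin 3) (ν : Fin 4) (x : Pos) :
    pderiv ν (field S (A + B) μ a) x = pderiv ν (field S A μ a) x + pderiv ν (field S B μ a) x := by
  have h := (hasPartialAt_field' S A μ a ν x).add (hasPartialAt_field' S B μ a ν x)
  have e : (fun y => field S A μ a y + field S B μ a y) = field S (A + B) μ a :=
    funext fun y => (field_add S A B μ a y).symm
  rw [e] at h
  exact h.pderiv_eq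

/-- The jet of `A_s + B_l` is the sum of the jets (`SectIV.FieldJet.add` of `…CurvatureDecomposition`).
[cite: MagnenRivasseauSeneor1993, §II.C (II.32b) p.338; §IV (IV.4) p.354] -/
theorem jetAt_add (A B : Config) (x : Pos) : jetAt S (A + B) x = (jetAt S A x).add (jetAt S B x) := by
  refine SectIV.FieldJet.ext' (fun μ => funext fun a => ?_) (fun μ ν => funext fun a => ?_)
  · simp only [jetAt_val, SectIV.FieldJet.add, Pi.add_apply, field_add, Complex.add_re]
  · simp only [jetAt_der, SectIV.FieldJet.add, Pi.add_apply, pderiv_field_add, Complex.add_re]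

/-- Reality is preserved under addition of configurations. [cite: MagnenRivasseauSeneor1993, §II.A p.328 tl.12–17] -/
theorem isRealOn_add {S : Finset Momentum} {A B : Config} (hA : IsRealOn S A) (hB : IsRealOn S B) :
    IsRealOn S (A + B) := fun p hp =>
  ⟨(hA p hp).1, fun μ a => by rw [coeff_add, coeff_add, (hA p hp).2 μ a, (hB p hp).2 μ a, map_add]⟩

/-- **(II.32c) LITERALLY IN POSITION SPACE — the rotated background `B′ = B^{rot γ,2}`**: `B′^a_ν(x) = B^a_ν(x) −
λ Σ_{bc} ε_abc B^b_ν(x) γ^c(x)` («B^{rot γ,2} = B − λ[B, γ]», the part of the truncated transformation linear in `B`).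
[cite: MagnenRivasseauSeneor1993, §II.C (II.32b)–(II.32c) p.338 tl.42–46, p.339 tl.2–3; §IV (IV.4) p.354] -/
def rotField (lam : ℝ) (B : Config) (K : Finset (Fin 4 → ℤ)) (d : Fin 3 → (Fin 4 → ℤ) → ℂ) (ν : Fin 4) (a : Fin 3)
    (x : Pos) : ℂ :=
  field S B ν a x - (lam : ℂ) * ∑ b, ∑ c, (TruncatedGauge.eps a b c : ℂ) * (field S B ν b x * trigPoly K (d c) x)

/-- **(II.32b) at `n = 2` IN POSITION SPACE: `(A_s + B_l)′ = A′_s + B′_l`** — the truncated transform of the decomposed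
field is the truncated transform of `A_s` plus the rotated background (the variables `(A′_s, B′_l)` of (IV.4)).
[cite: MagnenRivasseauSeneor1993, §II.C (II.32b) p.338 tl.42–44; §IV (IV.4) p.354] -/
theorem truncField_add (lam : ℝ) (A B : Config) (K : Finset (Fin 4 → ℤ)) (d : Fin 3 → (Fin 4 → ℤ) → ℂ) (ν : Fin 4)
    (a : Fin 3) (x : Pos) :
    truncField S lam (A + B) K d ν a x = truncField S lam A K d ν a x + rotField S lam B K d ν a x := by
  simp only [truncField, rotField, covDPos, field_add, add_mul, mul_add, Finset.sum_add_distrib]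
  ring

/-- The honest partial derivatives of `B′` (Leibniz rule on the commutator). [cite: MagnenRivasseauSeneor1993, (II.1) p.328 tl.28–30; §II.C (II.32c) p.339 tl.2–3] -/
theorem hasPartialAt_rotField (lam : ℝ) (B : Config) (K : Finset (Fin 4 → ℤ)) (d : Fin 3 → (Fin 4 → ℤ) → ℂ)
    (μ ν : Fin 4) (a : Fin 3) (x : Pos) :
    HasPartialAt μ (rotField S lam B K d ν a)
      (pderiv μ (field S B ν a) x
        - (lam : ℂ) * ∑ b, ∑ c, (TruncatedGauge.eps a b c : ℂ) * (pderiv μ (field S B ν b) x * trigPoly K (d c) x)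
        - (lam : ℂ) * ∑ b, ∑ c, (TruncatedGauge.eps a b c : ℂ) * (field S B ν b x * pderiv μ (trigPoly K (d c)) x)) x := by
  have hF := fun b => hasPartialAt_field' S B ν b μ x
  have hP := fun c => hasPartialAt_trigPoly' K (d c) μ x
  have h1 : HasPartialAt μ (fun y => ∑ b, ∑ c, (TruncatedGauge.eps a b c : ℂ) * (field S B ν b y * trigPoly K (d c) y))
      (∑ b, ∑ c, (TruncatedGauge.eps a b c : ℂ) *
        (pderiv μ (field S B ν b) x * trigPoly K (d c) x + field S B ν b x * pderiv μ (trigPoly K (d c)) x)) x :=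
    HasPartialAt.sum _ fun b _ => HasPartialAt.sum _ fun c _ => ((hF b).mul (hP c)).const_mul _
  have h := (hF a).sub (h1.const_mul (lam : ℂ))
  have e1 : (lam : ℂ) * ∑ b, ∑ c, (TruncatedGauge.eps a b c : ℂ) *
        (pderiv μ (field S B ν b) x * trigPoly K (d c) x + field S B ν b x * pderiv μ (trigPoly K (d c)) x) =
      (lam : ℂ) * ∑ b, ∑ c, (TruncatedGauge.eps a b c : ℂ) * (pderiv μ (field S B ν b) x * trigPoly K (d c) x)
        + (lam : ℂ) * ∑ b, ∑ c, (TruncatedGauge.eps a b c : ℂ) * (field S B ν b x * pderiv μ (trigPoly K (d c)) x) := by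
    simp only [mul_add, Finset.sum_add_distrib]
  rw [e1, ← sub_sub] at h
  exact h

/-- … `pderiv` form. [cite: MagnenRivasseauSeneor1993, (II.1) p.328 tl.28–30; §II.C (II.32c) p.339 tl.2–3] -/
theorem pderiv_rotField (lam : ℝ) (B : Config) (K : Finset (Fin 4 → ℤ)) (d : Fin 3 → (Fin 4 → ℤ) → ℂ)
    (μ ν : Fin 4) (a : Fin 3) (x : Pos) :
    pderiv μ (rotField S lam B K d ν a) x =
      pderiv μ (field S B ν a) x
        - (lam : ℂ) * ∑ b, ∑ c, (TruncatedGauge.eps a b c : ℂ) * (pderiv μ (field S B ν b) x * trigPoly K (d c) x)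
        - (lam : ℂ) * ∑ b, ∑ c, (TruncatedGauge.eps a b c : ℂ) * (field S B ν b x * pderiv μ (trigPoly K (d c)) x) :=
  (hasPartialAt_rotField S lam B K d μ ν a x).pderiv_eq

/-- The 1-jet of `B′` at `x` (real parts of values and honest partial derivatives). [cite: MagnenRivasseauSeneor1993, §II.C (II.32c) p.339 tl.2–3; §IV (IV.4) p.354] -/
def rotJetAt (lam : ℝ) (B : Config) (K : Finset (Fin 4 → ℤ)) (d : Fin 3 → (Fin 4 → ℤ) → ℂ) (x : Pos) :
    SectIV.FieldJet where
  val ν a := (rotField S lam B K d ν a x).re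
  der μ ν a := (pderiv μ (rotField S lam B K d ν a) x).re

/-- **THE JET OF THE POSITION-SPACE `B′` IS GEN 5's (II.32c)-ON-JETS**: for real cut-off `B`, `γ`,
`rotJetAt S λ B K γ̃ x = InfinitesimalGauge.rotTrunc λ (jetAt S B x) (gaugeJetAt K γ̃ x)` (whose derivative slot is the
Leibniz rule `∂_μB′_ν = ∂_μB_ν − λ[∂_μB_ν, γ] − λ[B_ν, ∂_μγ]`). [cite: MagnenRivasseauSeneor1993, §II.C (II.32c) p.339 tl.2–3; (II.1) p.328 tl.28–30] -/
theorem rotJetAt_eq (lam : ℝ) {S : Finset Momentum} {B : Config} (hB : IsRealOn S B) {K : Finset (Fin 4 → ℤ)}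
    {d : Fin 3 → (Fin 4 → ℤ) → ℂ} (hd : ∀ a, RealCoeff K (d a)) (x : Pos) :
    rotJetAt S lam B K d x = rotTrunc lam (jetAt S B x) (gaugeJetAt K d x) := by
  have hB0 : ∀ ν b, (field S B ν b x).im = 0 := fun ν b => field_im hB ν b x
  have hB1 : ∀ ν b μ, (pderiv μ (field S B ν b) x).im = 0 := fun ν b μ => pderiv_field_im hB ν b μ x
  have hP0 : ∀ c, (trigPoly K (d c) x).im = 0 := fun c => trigPoly_im (hd c) x
  have hP1 : ∀ c μ, (pderiv μ (trigPoly K (d c)) x).im = 0 := fun c μ => (pderiv_trigPoly_im (hd c) μ 0 x).1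
  refine SectIV.FieldJet.ext' (fun ν => funext fun a => ?_) (fun μ ν => funext fun a => ?_)
  · show (rotField S lam B K d ν a x).re = _
    simp only [rotTrunc, rotField, Pi.sub_apply, Pi.smul_apply, smul_eq_mul, jetAt_val, gaugeJetAt_val,
      TruncatedGauge.bracket, Complex.sub_re, Complex.ofReal_re, Complex.ofReal_im, Complex.re_sum, Complex.mul_re, hB0,
      hP0, mul_zero, zero_mul, sub_zero]
    simp only [mul_assoc]
  · show (pderiv μ (rotField S lam B K d ν a) x).re = _
    rw [pderiv_rotField]
    simp only [rotTrunc, Pi.sub_apply, Pi.smul_apply, smul_eq_mul, jetAt_val, jetAt_der, gaugeJetAt_val, gaugeJetAt_der,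
      TruncatedGauge.bracket, Complex.sub_re, Complex.ofReal_re, Complex.ofReal_im, Complex.re_sum, Complex.mul_re, hB0,
      hB1, hP0, hP1, mul_zero, zero_mul, sub_zero]
    simp only [mul_assoc]

/-- **(IV.2) FOR THE DECOMPOSED FIELD OVER `Λ`, in the variables `(A′_s, B′_l)` of (IV.4)**: for real cut-off `A_s`, `B_l`, `γ`,
`¼∫_Λ ΣF(A_s + B_l)² = ¼∫_Λ ΣF(A′_s + B′_l)² + ¼∫_Λ M(A_s + B_l, γ)`, where `A′_s`, `B′_l` are the position-space fields
`truncField`/`rotField` entering through their honest jets (gen 10's `eqIV2_add` pointwise, `jetAt_add`, `truncJetAt_eq`,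
`rotJetAt_eq`, gen 5's `gaugeTrunc2_add`). [cite: MagnenRivasseauSeneor1993, §IV (IV.2) p.353, (IV.4) p.354; §II.C (II.32b) p.338 tl.42–44] -/
theorem action_add_eq_integral (lam : ℝ) {S : Finset Momentum} {A B : Config} (hA : IsRealOn S A) (hB : IsRealOn S B)
    {K : Finset (Fin 4 → ℤ)} {d : Fin 3 → (Fin 4 → ℤ) → ℂ} (hd : ∀ a, RealCoeff K (d a)) :
    action S lam (A + B) =
      (1 / 4) * ∫ x, fieldStrengthSq lam ((truncJetAt S lam A K d x).add (rotJetAt S lam B K d x)) ∂vol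
        + (1 / 4) * ∫ x, defectM lam (jetAt S (A + B) x) (gaugeJetAt K d x) ∂vol := by
  have h := action_eq_truncAction_add lam (isRealOn_add hA hB) hd
  have e : ∀ x, truncJetAt S lam (A + B) K d x = (truncJetAt S lam A K d x).add (rotJetAt S lam B K d x) := fun x => by
    rw [truncJetAt_eq lam (isRealOn_add hA hB) hd, jetAt_add, gaugeTrunc2_add, truncJetAt_eq lam hA hd, rotJetAt_eq lam hB hd]
  rw [h, truncAction]
  simp_rw [e]

end PositionSpace

end Literature.MathematicalPhysics.QuantumFieldTheory.MagnenRivasseauSeneor1993
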